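import Literature.Computability.Complexity.CodeFPListKit
import Literature.Computability.Complexity.CodeFPModArith
import Mathlib.NumberTheory.ArithmeticFunction.Misc
import HarnessLib

/-!
# Indexing the divisors of an integer by its prime factorisation, in polynomial time

Topic `Computability/Complexity`, in the typed `FP` algebra `CodeFP` (`CodeFP.lean`, `CodeFPArith.lean`,
`CodeFPListKit.lean`, `CodeFPModArith.lean` for numeral sizes). Given the list of prime factors of `M ≥ 1` (with multiplicity, e.g. Mathlib's
`Nat.primeFactorsList M`, as delivered by a factoring oracle) and an index `j`, the **mixed-radix decoding**

  `j ↦ ∏ᵢ pᵢ ^ (digit i of j in the radices eᵢ + 1)`   (`p₁, p₂, …` the distinct primes of `M`, `eᵢ` their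
  multiplicities)

enumerates the `τ(M) = ∏ᵢ (eᵢ + 1)` divisors of `M` by the indices `j < τ(M)` (Hardy–Wright, Thm. 273:
`d(n) = ∏ (aᵢ + 1)`, the divisors being the `∏ pᵢ^{bᵢ}`, `0 ≤ bᵢ ≤ aᵢ`). This is how a randomised algorithm draws
a uniformly random divisor of a factored number from `⌈log₂ τ(M)⌉` coins without listing the (possibly
super-polynomially many) divisors. Proved here, definition-free (the decoder is exhibited by an `∃`):

* `CodeFP.exists_divisorIndex` — there is `dec : List ℕ → ℕ → ℕ`, computed on codes in polynomial time
  (`CodeFP (pairE (rawE natE) natE) natE`), with: for every `M ≠ 0` and every divisor `a ∣ M` some index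
  `j < #(M.divisors)` has `dec (M.primeFactorsList) j = a`.

The program: the list of first occurrences of the prime list (a fold), then a fold over it carrying
`(j, a) ↦ (j / (e_p + 1), a · p ^ (j mod (e_p + 1)))` (`rawCountNat` for `e_p`, `natPow` with the exponent in
unary, capped by the length of the prime list so that the accumulator stays polynomially bounded on all inputs).

## References

* G. H. Hardy, E. M. Wright, *An Introduction to the Theory of Numbers*, 6th ed., OUP 2008, §16.7 Thm. 273
  [HardyWright2008].
* S. Arora, B. Barak, *Computational Complexity: A Modern Approach*, CUP 2009, §1.3 (polynomially bounded
  loops) [AroraBarak2009].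
-/

namespace Literature.Computability.Complexity

namespace CodeFP

open _root_.Computability Polynomial Brick Finset

/-! ### First occurrences -/

/-- The first-occurrence fold keeps a duplicate-free accumulator and collects exactly the members.
[folklore] -/
theorem foldl_firstOcc_spec (l acc : List ℕ) (hacc : acc.Nodup) :
    (l.foldl (fun acc q => if decide (q ∈ acc) then acc else acc ++ [q]) acc).Nodup ∧
      ∀ x, x ∈ l.foldl (fun acc q => if decide (q ∈ acc) then acc else acc ++ [q]) acc ↔ x ∈ acc ∨ x ∈ l := by
  induction l generalizing acc with
  | nil => exact ⟨hacc, fun x => by simp⟩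
  | cons q l ih =>
    rw [List.foldl_cons]
    by_cases hq : q ∈ acc
    · rw [decide_eq_true hq, if_pos rfl]
      obtain ⟨h1, h2⟩ := ih acc hacc
      refine ⟨h1, fun x => ?_⟩
      rw [h2, List.mem_cons]
      constructor
      · rintro (h | h)
        · exact Or.inl h
        · exact Or.inr (Or.inr h)
      · rintro (h | rfl | h)
        · exact Or.inl h
        · exact Or.inl hq
        · exact Or.inr h
    · rw [decide_eq_false hq]
      simp only [Bool.false_eq_true, ↓reduceIte]
      have hacc' : (acc ++ [q]).Nodup := by
        rw [List.nodup_append]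
        exact ⟨hacc, List.nodup_singleton q, fun x hx y hy => by
          rw [List.mem_singleton] at hy; subst hy; rintro rfl; exact hq hx⟩
      obtain ⟨h1, h2⟩ := ih (acc ++ [q]) hacc'
      refine ⟨h1, fun x => ?_⟩
      rw [h2, List.mem_append, List.mem_singleton, List.mem_cons, or_assoc]

/-- **The list of first occurrences is computed on codes** (`rawE natE → rawE natE`).
[cite: AroraBarak2009, §1.3] -/
theorem firstOcc : CodeFP (rawE natE) (rawE natE)
    (fun l => l.foldl (fun acc q => if decide (q ∈ acc) then acc else acc ++ [q]) []) := by
  have hstep : CodeFP (pairE natE (rawE natE)) (rawE natE)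
      (fun t => if decide (t.1 ∈ t.2) then t.2 else t.2 ++ [t.1]) :=
    (mem natE_injective).ite (snd _ _) ((rawAppend natE).comp ((snd _ _).pair ((rawSingleton natE).comp (fst _ _))))
  refine foldl₀ (eα := natE) (eβ := rawE natE) (b₀ := ([] : List ℕ)) hstep X fun l₁ l₂ => ?_
  rw [eval_X]
  obtain ⟨h1, h2⟩ := foldl_firstOcc_spec l₁ [] List.nodup_nil
  exact length_rawE_le_of_nodup_subset natE h1 fun a ha => by
    rcases (h2 a).1 ha with h | h
    · exact absurd h List.not_mem_nil
    · exact List.mem_append_left l₂ h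

/-! ### The mixed-radix fold -/

/-- The index of a digit vector `f` in the mixed radices `R` along the list `ps`:
`idx (p :: ps) = f p + R p · idx ps`. (Local notation for the statements below: written out as a `foldr`.)
The fold `(j, a) ↦ (j / R p, a · p ^ (j mod R p))` started at the index of `f` ends at `(0, a · ∏ p ^ f p)`.
[cite: HardyWright2008, Thm. 273] -/
theorem foldl_mixedRadix (R f : ℕ → ℕ) : ∀ (ps : List ℕ) (A : ℕ), (∀ p ∈ ps, f p < R p) →
    ps.foldl (fun st p => (st.1 / R p, st.2 * p ^ (st.1 % R p)))
        (ps.foldr (fun p i => f p + R p * i) 0, A) = (0, A * (ps.map fun p => p ^ f p).prod)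
  | [], A, _ => by simp
  | p :: ps, A, h => by
    have hp : f p < R p := h p List.mem_cons_self
    have hR : 0 < R p := lt_of_le_of_lt (Nat.zero_le _) hp
    rw [List.foldr_cons, List.foldl_cons, List.map_cons, List.prod_cons]
    have h1 : (f p + R p * ps.foldr (fun p i => f p + R p * i) 0) / R p = ps.foldr (fun p i => f p + R p * i) 0 := by
      rw [Nat.add_mul_div_left _ _ hR, Nat.div_eq_of_lt hp, zero_add]
    have h2 : (f p + R p * ps.foldr (fun p i => f p + R p * i) 0) % R p = f p := by
      rw [Nat.add_mul_mod_self_left, Nat.mod_eq_of_lt hp]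
    simp only [h1, h2]
    rw [foldl_mixedRadix R f ps _ fun q hq => h q (List.mem_cons_of_mem p hq), mul_assoc]

/-- The index of a digit vector is below the product of the radices. [cite: HardyWright2008, Thm. 273] -/
theorem foldr_mixedRadix_lt (R f : ℕ → ℕ) : ∀ ps : List ℕ, (∀ p ∈ ps, f p < R p) →
    ps.foldr (fun p i => f p + R p * i) 0 < (ps.map R).prod
  | [], _ => by simp
  | p :: ps, h => by
    have hp : f p < R p := h p List.mem_cons_self
    have ih := foldr_mixedRadix_lt R f ps fun q hq => h q (List.mem_cons_of_mem p hq)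
    rw [List.foldr_cons, List.map_cons, List.prod_cons]
    calc f p + R p * ps.foldr (fun p i => f p + R p * i) 0
        < R p + R p * ps.foldr (fun p i => f p + R p * i) 0 := by omega
      _ = R p * (ps.foldr (fun p i => f p + R p * i) 0 + 1) := by ring
      _ ≤ R p * (ps.map R).prod := Nat.mul_le_mul_left _ ih

/-- Growth of the mixed-radix accumulator along any list: the index only decreases, and each step
multiplies by a power with exponent at most the cap `C`. [folklore] -/
theorem foldl_mixedRadix_bound (R : ℕ → ℕ) (C W : ℕ) : ∀ (ps : List ℕ) (J A : ℕ), (∀ p ∈ ps, (natE p).length ≤ W) →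
    (ps.foldl (fun st p => (st.1 / R p, st.2 * p ^ min (st.1 % R p) C)) (J, A)).1 ≤ J ∧
    (natE (ps.foldl (fun st p => (st.1 / R p, st.2 * p ^ min (st.1 % R p) C)) (J, A)).2).length ≤
      (natE A).length + ps.length * (C * W + 1)
  | [], J, A, _ => by simp
  | p :: ps, J, A, h => by
    rw [List.foldl_cons]
    have hW : (natE p).length ≤ W := h p List.mem_cons_self
    obtain ⟨h1, h2⟩ := foldl_mixedRadix_bound R C W ps (J / R p) (A * p ^ min (J % R p) C)
      fun q hq => h q (List.mem_cons_of_mem p hq)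
    refine ⟨h1.trans (Nat.div_le_self _ _), h2.trans ?_⟩
    have h3 := length_natE_mul_le A (p ^ min (J % R p) C)
    have h4 := length_natE_pow_le p (min (J % R p) C)
    have h5 : min (J % R p) C * (natE p).length ≤ C * W := Nat.mul_le_mul (min_le_right _ _) hW
    rw [List.length_cons]
    nlinarith

/-- **The mixed-radix divisor decoder is computed on codes**: `(L, j) ↦ (fold over the first occurrences
`p` of `L` of `(j, a) ↦ (j / (count p L + 1), a · p ^ min (j mod (count p L + 1)) |L|)` from `(j, 1)`).2`.
[cite: AroraBarak2009, §1.3] -/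
theorem mixedRadixDecode : CodeFP (pairE (rawE natE) natE) natE (fun Lj =>
    ((Lj.1.foldl (fun acc q => if decide (q ∈ acc) then acc else acc ++ [q]) []).foldl
      (fun st p => (st.1 / (Lj.1.count p + 1), st.2 * p ^ min (st.1 % (Lj.1.count p + 1)) Lj.1.length))
      (Lj.2, 1)).2) := by
  -- fields of `t = ((L, j), (p, (j', a)))`
  have cL : CodeFP (pairE (pairE (rawE natE) natE) (pairE natE (pairE natE natE))) (rawE natE) (fun t => t.1.1) :=
    (fst _ _).fst'
  have cP : CodeFP (pairE (pairE (rawE natE) natE) (pairE natE (pairE natE natE))) natE (fun t => t.2.1) :=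
    (snd _ _).fst'
  have cJ : CodeFP (pairE (pairE (rawE natE) natE) (pairE natE (pairE natE natE))) natE (fun t => t.2.2.1) :=
    (snd _ _).snd'.fst'
  have cA : CodeFP (pairE (pairE (rawE natE) natE) (pairE natE (pairE natE natE))) natE (fun t => t.2.2.2) :=
    (snd _ _).snd'.snd'
  have cR : CodeFP (pairE (pairE (rawE natE) natE) (pairE natE (pairE natE natE))) natE
      (fun t => t.1.1.count t.2.1 + 1) := natAdd.comp ((rawCountNat.comp (cP.pair cL)).pair (const _ 1))
  have cE : CodeFP (pairE (pairE (rawE natE) natE) (pairE natE (pairE natE natE))) unE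
      (fun t => min (t.2.2.1 % (t.1.1.count t.2.1 + 1)) t.1.1.length) :=
    unOfNatMin.comp (((ulength natE).comp cL).pair (natMod.comp (cJ.pair cR)))
  have hstep : CodeFP (pairE (pairE (rawE natE) natE) (pairE natE (pairE natE natE))) (pairE natE natE)
      (fun t => (t.2.2.1 / (t.1.1.count t.2.1 + 1),
        t.2.2.2 * t.2.1 ^ min (t.2.2.1 % (t.1.1.count t.2.1 + 1)) t.1.1.length)) :=
    (natDiv.comp (cJ.pair cR)).pair (natMul.comp (cA.pair (natPow.comp (cP.pair cE))))
  have hinit : CodeFP (pairE (rawE natE) natE) (pairE natE natE) (fun s => (s.2, 1)) := (snd _ _).pair (const _ 1)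
  have hfold := foldl (σ := List ℕ × ℕ) (α := ℕ) (β := ℕ × ℕ) (eσ := pairE (rawE natE) natE) (eα := natE)
    (eβ := pairE natE natE)
    (step := fun s p st => (st.1 / (s.1.count p + 1), st.2 * p ^ min (st.1 % (s.1.count p + 1)) s.1.length))
    (init := fun s => (s.2, 1)) hstep hinit (X ^ 3 + 3 * X + 3) (fun s l₁ l₂ => by
      set N := (pairE (pairE (rawE natE) natE) (rawE natE) (s, l₁ ++ l₂)).length with hN
      have hNeq : N = 2 * (2 * (rawE natE s.1).length + 2 + (natE s.2).length) + 2 + (rawE natE (l₁ ++ l₂)).length := by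
        rw [hN, pairE_apply, length_boolPair, pairE_apply, length_boolPair]
      have hW : ∀ p ∈ l₁, (natE p).length ≤ N := fun p hp => by
        have := length_item_le_length_rawE natE (List.mem_append_left l₂ hp); omega
      obtain ⟨h1, h2⟩ := foldl_mixedRadix_bound (fun p => s.1.count p + 1) s.1.length N l₁ s.2 1 hW
      set st := l₁.foldl (fun st p => (st.1 / (s.1.count p + 1),
        st.2 * p ^ min (st.1 % (s.1.count p + 1)) s.1.length)) (s.2, 1) with hst
      have h3 : (natE st.1).length ≤ N := (length_natE_mono h1).trans (by omega)
      have h4 : l₁.length ≤ N := ((List.sublist_append_left l₁ l₂).length_le).trans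
        ((length_le_length_rawE natE _).trans (by omega))
      have h5 : s.1.length ≤ N := (length_le_length_rawE natE _).trans (by omega)
      have h6 : (natE (1 : ℕ)).length = 1 := by decide
      rw [h6] at h2
      have h7 : (natE st.2).length ≤ 1 + N * (N * N + 1) := by
        refine h2.trans ?_
        have h8 : s.1.length * N + 1 ≤ N * N + 1 := Nat.add_le_add_right (Nat.mul_le_mul h5 le_rfl) 1
        have h9 : l₁.length * (s.1.length * N + 1) ≤ N * (N * N + 1) := Nat.mul_le_mul h4 h8
        omega
      rw [pairE_apply, length_boolPair]
      simp only [eval_add, eval_pow, eval_mul, eval_X, eval_ofNat]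
      nlinarith [h3, h7])
  exact (CodeFP.comp hfold ((CodeFP.id _).pair (firstOcc.comp (fst _ _)))).snd'

/-- **Indexing the divisors in polynomial time.** There is a decoder `dec : List ℕ → ℕ → ℕ`, computed on
codes in polynomial time, such that for every `M ≠ 0` each divisor `a` of `M` is `dec (M.primeFactorsList) j` for
some index `j < τ(M) = #(M.divisors)`: with `p₁, …, p_k` the distinct primes of `M` in order of appearance and
`eᵢ` their multiplicities, `dec` reads `j` in the mixed radices `eᵢ + 1` and returns `∏ pᵢ^{digitᵢ}`; the divisor
`a = ∏ pᵢ^{bᵢ}`, `bᵢ ≤ eᵢ`, is hit by `j = Σᵢ bᵢ ∏_{i' < i} (e_{i'} + 1) < ∏ (eᵢ + 1) = τ(M)` (Hardy–Wright, Thm. 273).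
[cite: HardyWright2008, §16.7 Thm. 273] -/
theorem exists_divisorIndex : ∃ dec : List ℕ → ℕ → ℕ,
    CodeFP (pairE (rawE natE) natE) natE (fun Lj => dec Lj.1 Lj.2) ∧
    ∀ M : ℕ, M ≠ 0 → ∀ a : ℕ, a ∣ M → ∃ j : ℕ, j < M.divisors.card ∧ dec M.primeFactorsList j = a := by
  classical
  refine ⟨fun L j => ((L.foldl (fun acc q => if decide (q ∈ acc) then acc else acc ++ [q]) []).foldl
      (fun st p => (st.1 / (L.count p + 1), st.2 * p ^ min (st.1 % (L.count p + 1)) L.length)) (j, 1)).2,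
    mixedRadixDecode, fun M hM a ha => ?_⟩
  set L := M.primeFactorsList with hL
  set P := L.foldl (fun acc q => if decide (q ∈ acc) then acc else acc ++ [q]) [] with hP
  obtain ⟨hPnd, hPmem⟩ := foldl_firstOcc_spec L [] List.nodup_nil
  have hPmem' : ∀ x, x ∈ P ↔ x ∈ L := fun x => by rw [hP, hPmem]; simp
  have hPfin : P.toFinset = M.primeFactors := by
    rw [← Nat.toFinset_factors]
    ext x
    rw [List.mem_toFinset, List.mem_toFinset, hPmem']
  have ha0 : a ≠ 0 := fun h => hM (zero_dvd_iff.1 (h ▸ ha))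
  -- radices and digits
  set R : ℕ → ℕ := fun p => L.count p + 1 with hR
  set f : ℕ → ℕ := fun p => a.factorization p with hf
  have hfR : ∀ p ∈ P, f p < R p := fun p _ => by
    rw [hR, hf]
    show a.factorization p < L.count p + 1
    rw [hL, Nat.primeFactorsList_count_eq]
    exact Nat.lt_succ_of_le ((Nat.factorization_le_iff_dvd ha0 hM).2 ha p)
  -- the cap is never active
  have hstep : (fun st p => (st.1 / (L.count p + 1), st.2 * p ^ min (st.1 % (L.count p + 1)) L.length)) =
      fun (st : ℕ × ℕ) p => (st.1 / R p, st.2 * p ^ (st.1 % R p)) := by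
    funext st p
    have : st.1 % (L.count p + 1) ≤ L.length :=
      (Nat.lt_succ_iff.1 (Nat.mod_lt _ (Nat.succ_pos _))).trans List.count_le_length
    rw [min_eq_left this]
  refine ⟨P.foldr (fun p i => f p + R p * i) 0, ?_, ?_⟩
  · -- `j < τ(M)`
    refine (foldr_mixedRadix_lt R f P hfR).trans_le (le_of_eq ?_)
    rw [Nat.card_divisors hM, ← hPfin, List.prod_toFinset _ hPnd]
    refine congrArg List.prod (List.map_congr_left fun p hp => ?_)
    show L.count p + 1 = M.factorization p + 1
    rw [hL, Nat.primeFactorsList_count_eq]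
  · show (P.foldl (fun st p => (st.1 / (L.count p + 1), st.2 * p ^ min (st.1 % (L.count p + 1)) L.length))
      (P.foldr (fun p i => f p + R p * i) 0, 1)).2 = a
    rw [hstep, foldl_mixedRadix R f P 1 hfR, one_mul, ← List.prod_toFinset _ hPnd, hPfin]
    conv_rhs => rw [← Nat.prod_factorization_pow_eq_self ha0]
    rw [Finsupp.prod_of_support_subset _ (s := M.primeFactors)]
    · rw [Nat.support_factorization]; exact Nat.primeFactors_mono ha hM
    · intro p _; exact pow_zero p

end CodeFP

end Literature.Computability.Complexity
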